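import Summits.NavierStokesRegularity.NavierStokesRegularity.Theorems.ExtremiserTransienceNearExtremalTransienceExtremiserLiouvilleConstantSpeedSlideInequality
import Summits.NavierStokesRegularity.NavierStokesRegularity.Theorems.ExtremiserTransienceNearExtremalTransienceExtremiserLiouvilleConstantSpeedSlideStretchingDensity
import Summits.NavierStokesRegularity.NavierStokesRegularity.Theorems.ExtremiserTransienceNearExtremalTransienceExtremiserLiouvilleConstantSpeedSlideEnstrophyLawJet
import HarnessLib

/-!
# Crux `ExtremiserTransience.NearExtremalTransience` (stmt-NavierStokesRegularity-21883), line `extremiser_liouville`,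
# stub K1b — **(INEQ)₂: the slide inequality with ALL variations EXPLICIT** (record §14, R6a-W + R6a-Z + R6a-S, pointwise parts)

`--supports stmt-NavierStokesRegularity-21883` (helper).  Author: prover seat `ns-el-k1b` (g9).

`slideInequality` (p733038) is `S·J₁(−φ_g) ≤ κ⋆²M²(∫|Dω|²_F·a₁(−φ_g) + ∫‖ω‖²·ĉ₁)` with `a₁`, `ĉ₁` as unexpanded integrals.  Here both are made
EXPLICIT quadratic forms in `(DV, D²V)` weighted by `g′, g″, g‴`:
* `a₁(−φ_g) = −a₁(φ_g)` with `a₁(φ_g)` = `slideEnstrophyLaw_jet` (p721994: `(3/2)|∂₂V_h|² + ½ω₂² − ½|∇_hV₂|² − ⟪∇_hV₂,∂₂V_h⟫`-form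
  plus the kinematic terms `2(∂₂V₂)² + 2⟪∇_hV₂,∂₂V_h⟫`, all `g′`-weighted — the `W′`-line);
* the two densities of `ĉ₁` by `sum_inner_fderiv_curlRemainder_axis` / `sum_inner_slideCoeffDeriv` (…SlidePalinstrophyDensity).
* `J₁(−φ_g) = −∫(identity (S))` by `stretchingDensity_slideGenerator` (…SlideStretchingDensity).
Result `slideInequality_explicit` = (INEQ)₂: ALL THREE variations are explicit integrands in `(V, DV, D²V)` weighted by
`g, g′, g″, g‴` (the only `g`-weighted one is the exact axial derivative `g·∂₂⟪ω,DVω⟫`, removed by the axial rule in R6a-S).  Hypotheses: those of `slideInequality` with the layer support stated on `{T ≤ |s|}` and `T > 0`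
(as in p721994).  Next (R6a-Z integrated, R6b): integrate by parts to the coercive (T1)+(T2)+(C) form and absorb ⇒ (DEC) ⇒
`windowEnergy_nonpos_of_expDecay` (p733230).

WHAT THIS IS NOT: K1b is NOT proved; nothing here proves NS regularity. [folklore]
-/

noncomputable section

open Set Filter Topology MeasureTheory Metric Function InnerProductSpace
open scoped ENNReal NNReal Topology InnerProductSpace RealInnerProductSpace ContDiff
open Literature.Analysis.FluidPDE Literature.Analysis

namespace Summit.NavierStokesRegularity.NavierStokesRegularity.Theorems

-- the problem directory repeats the summit name (`NavierStokesRegularity/NavierStokesRegularity`)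
set_option linter.dupNamespace false

namespace ExtremiserLiouville

open DepletionLadder.KStar

variable {v : EuclideanSpace ℝ (Fin 3) → EuclideanSpace ℝ (Fin 3)} {c : EuclideanSpace ℝ (Fin 3)} {g : ℝ → ℝ}

/-- `‖∂_e∂_eV(x)‖ ≤ ‖D²V(x)‖` for a unit vector `e`: the iterated directional derivative is bounded by `D²V`. [folklore] -/
theorem norm_fderiv_fderiv_apply_le (hv : ContDiff ℝ ∞ v) (x e : EuclideanSpace ℝ (Fin 3)) (he : ‖e‖ = 1) :
    ‖fderiv ℝ (fun y => fderiv ℝ v y e) x e‖ ≤ ‖iteratedFDeriv ℝ 2 v x‖ := by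
  have hD : ContDiff ℝ ∞ (fderiv ℝ v) := hv.fderiv_right (m := ∞) (by exact_mod_cast le_rfl)
  have e1 : ‖iteratedFDeriv ℝ 0 (fderiv ℝ (fun y => fderiv ℝ v y e)) x‖ = ‖iteratedFDeriv ℝ 1 (fun y => fderiv ℝ v y e) x‖ :=
    norm_iteratedFDeriv_fderiv
  have e2 : ‖iteratedFDeriv ℝ 1 (fderiv ℝ v) x‖ = ‖iteratedFDeriv ℝ 2 v x‖ := norm_iteratedFDeriv_fderiv
  rw [norm_iteratedFDeriv_zero] at e1
  calc ‖fderiv ℝ (fun y => fderiv ℝ v y e) x e‖ ≤ ‖fderiv ℝ (fun y => fderiv ℝ v y e) x‖ * ‖e‖ := ContinuousLinearMap.le_opNorm _ _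
    _ = ‖iteratedFDeriv ℝ 1 (fun y => fderiv ℝ v y e) x‖ := by rw [he, mul_one, e1]
    _ ≤ ‖e‖ * ‖iteratedFDeriv ℝ 1 (fderiv ℝ v) x‖ :=
        norm_iteratedFDeriv_clm_apply_const (hD.of_le (by exact_mod_cast le_top)).contDiffAt le_rfl
    _ = ‖iteratedFDeriv ℝ 2 v x‖ := by rw [he, one_mul, e2]

/-- **(INEQ)₂ — the slide inequality with explicit stretching, enstrophy and (regularised) palinstrophy variations.**  Hypotheses as in
`slideInequality` (layer support on `{T ≤ |s|}`, `T > 0`); conclusion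
`S·(−J₁(φ_g))_explicit ≤ κ⋆²M²·( ∫|Dω|²_F · (−a₁(φ_g))_explicit + ∫‖ω‖² · (ĉ₁)_explicit )`. [folklore] -/
theorem slideInequality_explicit
    (hv : ContDiff ℝ ∞ v) (hdiv : VectorCalculus.IsDivFree v) {M B : ℝ} (hMpos : 0 < M)
    (hM : ∀ x, ‖v x‖ = M) (hB : ∀ x, ‖fderiv ℝ v x‖ ≤ B)
    (h1 : ∫⁻ x, ‖iteratedFDeriv ℝ 1 v x‖ₑ ^ 2 < ⊤) (h2 : ∫⁻ x, ‖iteratedFDeriv ℝ 2 v x‖ₑ ^ 2 < ⊤)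
    (hatt : |∫ x, ⟪curl v x, fderiv ℝ v x (curl v x)⟫| = (sInf {κ : ℝ | (∀ (v : EuclideanSpace ℝ (Fin 3) → EuclideanSpace ℝ (Fin 3)) (M B : ℝ), ContDiff ℝ (⊤ : ℕ∞) v → Literature.Analysis.FluidPDE.VectorCalculus.IsDivFree v → (∀ x, ‖v x‖ ≤ M) → (∀ x, ‖fderiv ℝ v x‖ ≤ B) → (∫⁻ x, ‖iteratedFDeriv ℝ 0 v x‖ₑ ^ 2 < ⊤) → (∫⁻ x, ‖iteratedFDeriv ℝ 1 v x‖ₑ ^ 2 < ⊤) → (∫⁻ x, ‖iteratedFDeriv ℝ 2 v x‖ₑ ^ 2 < ⊤) → |∫ x, ⟪Literature.Analysis.FluidPDE.curl v x, fderiv ℝ v x (Literature.Analysis.FluidPDE.curl v x)⟫_ℝ| ≤ κ * M * Real.sqrt (∫ x, ‖Literature.Analysis.FluidPDE.curl v x‖ ^ 2) * Real.sqrt (∫ x, Literature.Analysis.FluidPDE.frobeniusNormSq (fderiv ℝ (Literature.Analysis.FluidPDE.curl v) x)))}) * M * Real.sqrt (∫ x, ‖curl v x‖ ^ 2) * Real.sqrt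 (∫ x, frobeniusNormSq (fderiv ℝ (curl v) x)))
    (hc0 : c 0 = 0) (hc1 : c 1 = 0) (hcM : ‖c‖ = M)
    (hg : ContDiff ℝ ∞ g) {T K0 K1 K2 K3 : ℝ} (hT : 0 < T)
    (hK0 : ∀ s, |g s| ≤ K0) (hK1 : ∀ s, |deriv g s| ≤ K1) (hK2 : ∀ s, |deriv (deriv g) s| ≤ K2)
    (hK3 : ∀ s, |deriv (deriv (deriv g)) s| ≤ K3)
    (hT1 : ∀ s, T ≤ |s| → deriv g s = 0) (hT2 : ∀ s, T ≤ |s| → deriv (deriv g) s = 0)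
    (hT3 : ∀ s, T ≤ |s| → deriv (deriv (deriv g)) s = 0)
    (hg0 : ∀ s, 0 ≤ g s) (hγ0 : ∀ s, 0 ≤ deriv g s)
    (hslab : Integrable (fun x => {x : EuclideanSpace ℝ (Fin 3) | |x 2| ≤ T}.indicator (fun x => ‖v x - c‖ ^ 2) x) volume)
    {h₀ : ℝ} (hh₀ : 0 < h₀) (hfar : ∀ x : EuclideanSpace ℝ (Fin 3), |x 2| ≤ T + h₀ → ‖v x - c‖ ^ 2 ≤ 2 * M ^ 2) :
    (∫ x, ⟪curl v x, fderiv ℝ v x (curl v x)⟫) *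
        (-(∫ x, (g (x 2) * fderiv ℝ (fun y : EuclideanSpace ℝ (Fin 3) => ⟪curl v y, fderiv ℝ v y (curl v y)⟫) x (EuclideanSpace.single (2 : Fin 3) (1 : ℝ)) +
        deriv g (x 2) *
          (⟪((-2 * fderiv ℝ v x (EuclideanSpace.single (2 : Fin 3) (1 : ℝ)) 1) • EuclideanSpace.single (0 : Fin 3) (1 : ℝ) + (2 * fderiv ℝ v x (EuclideanSpace.single (2 : Fin 3) (1 : ℝ)) 0) • EuclideanSpace.single (1 : Fin 3) (1 : ℝ) + (curl v x 2) • EuclideanSpace.single (2 : Fin 3) (1 : ℝ)), fderiv ℝ v x (curl v x)⟫ +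
            curl v x 2 * ⟪curl v x, fderiv ℝ v x (EuclideanSpace.single (2 : Fin 3) (1 : ℝ))⟫ +
            ⟪curl v x, fderiv ℝ v x (curl v x) - (fderiv ℝ v x (curl v x) 2) • EuclideanSpace.single (2 : Fin 3) (1 : ℝ)⟫ +
            ⟪curl v x, fderiv ℝ v x ((-2 * fderiv ℝ v x (EuclideanSpace.single (2 : Fin 3) (1 : ℝ)) 1) • EuclideanSpace.single (0 : Fin 3) (1 : ℝ) + (2 * fderiv ℝ v x (EuclideanSpace.single (2 : Fin 3) (1 : ℝ)) 0) • EuclideanSpace.single (1 : Fin 3) (1 : ℝ) + (curl v x 2) • EuclideanSpace.single (2 : Fin 3) (1 : ℝ))⟫) +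
        deriv (deriv g) (x 2) *
          (⟪((-(v x - c) 1) • EuclideanSpace.single (0 : Fin 3) (1 : ℝ) + ((v x - c) 0) • EuclideanSpace.single (1 : Fin 3) (1 : ℝ)), fderiv ℝ v x (curl v x)⟫ +
            curl v x 2 * ⟪curl v x, v x - c - ((v x - c) 2) • EuclideanSpace.single (2 : Fin 3) (1 : ℝ)⟫ +
            ⟪curl v x, fderiv ℝ v x ((-(v x - c) 1) • EuclideanSpace.single (0 : Fin 3) (1 : ℝ) + ((v x - c) 0) • EuclideanSpace.single (1 : Fin 3) (1 : ℝ))⟫)))) ≤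
      (sInf {κ : ℝ | (∀ (v : EuclideanSpace ℝ (Fin 3) → EuclideanSpace ℝ (Fin 3)) (M B : ℝ), ContDiff ℝ (⊤ : ℕ∞) v → Literature.Analysis.FluidPDE.VectorCalculus.IsDivFree v → (∀ x, ‖v x‖ ≤ M) → (∀ x, ‖fderiv ℝ v x‖ ≤ B) → (∫⁻ x, ‖iteratedFDeriv ℝ 0 v x‖ₑ ^ 2 < ⊤) → (∫⁻ x, ‖iteratedFDeriv ℝ 1 v x‖ₑ ^ 2 < ⊤) → (∫⁻ x, ‖iteratedFDeriv ℝ 2 v x‖ₑ ^ 2 < ⊤) → |∫ x, ⟪Literature.Analysis.FluidPDE.curl v x, fderiv ℝ v x (Literature.Analysis.FluidPDE.curl v x)⟫_ℝ| ≤ κ * M * Real.sqrt (∫ x, ‖Literature.Analysis.FluidPDE.curl v x‖ ^ 2) * Real.sqrt (∫ x, Literature.Analysis.FluidPDE.frobeniusNormSq (fderiv ℝ (Literature.Analysis.FluidPDE.curl v) x)))}) ^ 2 * M ^ 2 *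
        ((∫ x, frobeniusNormSq (fderiv ℝ (curl v) x)) *
          (-((∫ x, deriv g (x 2) *
          ((3 / 2) * (fderiv ℝ v x (EuclideanSpace.single 2 1) 0 ^ 2 + fderiv ℝ v x (EuclideanSpace.single 2 1) 1 ^ 2) +
            (1 / 2) * curl v x 2 ^ 2 -
            (1 / 2) * (fderiv ℝ v x (EuclideanSpace.single 0 1) 2 ^ 2 + fderiv ℝ v x (EuclideanSpace.single 1 1) 2 ^ 2) -
            (fderiv ℝ v x (EuclideanSpace.single 0 1) 2 * fderiv ℝ v x (EuclideanSpace.single 2 1) 0 +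
              fderiv ℝ v x (EuclideanSpace.single 1 1) 2 * fderiv ℝ v x (EuclideanSpace.single 2 1) 1))) +
        2 * (∫ x, deriv g (x 2) * (fderiv ℝ v x (EuclideanSpace.single (2 : Fin 3) (1 : ℝ)) 2) ^ 2) +
        2 * ∫ x, deriv g (x 2) *
          (fderiv ℝ v x (EuclideanSpace.single 0 1) 2 * fderiv ℝ v x (EuclideanSpace.single 2 1) 0 +
            fderiv ℝ v x (EuclideanSpace.single 1 1) 2 * fderiv ℝ v x (EuclideanSpace.single 2 1) 1))) +
          (∫ x, ‖curl v x‖ ^ 2) *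
          (-((1 / 2) * ∫ x, deriv g (x 2) * frobeniusNormSq (fderiv ℝ (curl v) x)) -
          (∫ x, deriv (deriv g) (x 2) * ⟪fderiv ℝ (curl v) x (EuclideanSpace.single (2 : Fin 3) (1 : ℝ)), curl v x⟫ +
        deriv g (x 2) * ‖fderiv ℝ (curl v) x (EuclideanSpace.single (2 : Fin 3) (1 : ℝ))‖ ^ 2 +
        deriv (deriv (deriv g)) (x 2) * ⟪fderiv ℝ (curl v) x (EuclideanSpace.single (2 : Fin 3) (1 : ℝ)),
          (-(v x - c) 1) • EuclideanSpace.single (0 : Fin 3) (1 : ℝ) + ((v x - c) 0) • EuclideanSpace.single (1 : Fin 3) (1 : ℝ)⟫ +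
        deriv (deriv g) (x 2) * ⟪fderiv ℝ (curl v) x (EuclideanSpace.single (2 : Fin 3) (1 : ℝ)),
          fderiv ℝ (fun z : EuclideanSpace ℝ (Fin 3) =>
            (-(v z - c) 1) • EuclideanSpace.single (0 : Fin 3) (1 : ℝ) + ((v z - c) 0) • EuclideanSpace.single (1 : Fin 3) (1 : ℝ)) x
            (EuclideanSpace.single (2 : Fin 3) (1 : ℝ))⟫ +
        ∑ i : Fin 3, (deriv (deriv g) (x 2) * ⟪fderiv ℝ (curl v) x (EuclideanSpace.basisFun (Fin 3) ℝ i),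
            fderiv ℝ (fun z : EuclideanSpace ℝ (Fin 3) =>
              (-(v z - c) 1) • EuclideanSpace.single (0 : Fin 3) (1 : ℝ) + ((v z - c) 0) • EuclideanSpace.single (1 : Fin 3) (1 : ℝ)) x
              (EuclideanSpace.basisFun (Fin 3) ℝ i)⟫ +
          deriv g (x 2) * ⟪fderiv ℝ (curl v) x (EuclideanSpace.basisFun (Fin 3) ℝ i),
            fderiv ℝ (fun y : EuclideanSpace ℝ (Fin 3) => fderiv ℝ (fun z : EuclideanSpace ℝ (Fin 3) =>
              (-(v z - c) 1) • EuclideanSpace.single (0 : Fin 3) (1 : ℝ) + ((v z - c) 0) • EuclideanSpace.single (1 : Fin 3) (1 : ℝ)) y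
              (EuclideanSpace.basisFun (Fin 3) ℝ i)) x (EuclideanSpace.single (2 : Fin 3) (1 : ℝ))⟫)) +
          ∫ x, deriv (deriv g) (x 2) * (fderiv ℝ (curl v) x (EuclideanSpace.single (2 : Fin 3) (1 : ℝ)) 0 * fderiv ℝ v x (EuclideanSpace.single (1 : Fin 3) (1 : ℝ)) 2 -
          fderiv ℝ (curl v) x (EuclideanSpace.single (2 : Fin 3) (1 : ℝ)) 1 * fderiv ℝ v x (EuclideanSpace.single (0 : Fin 3) (1 : ℝ)) 2) +
        deriv g (x 2) * ∑ i : Fin 3, (fderiv ℝ (curl v) x (EuclideanSpace.basisFun (Fin 3) ℝ i) 0 *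
            fderiv ℝ (fun y => fderiv ℝ v y (EuclideanSpace.single (1 : Fin 3) (1 : ℝ))) x (EuclideanSpace.basisFun (Fin 3) ℝ i) 2 -
          fderiv ℝ (curl v) x (EuclideanSpace.basisFun (Fin 3) ℝ i) 1 *
            fderiv ℝ (fun y => fderiv ℝ v y (EuclideanSpace.single (0 : Fin 3) (1 : ℝ))) x (EuclideanSpace.basisFun (Fin 3) ℝ i) 2))) := by
  have e2n : ‖(EuclideanSpace.single (2 : Fin 3) (1 : ℝ))‖ = 1 := by rw [PiLp.norm_single, norm_one]
  have hT1' : ∀ s, T < |s| → deriv g s = 0 := fun s hs => hT1 s hs.le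
  have hT2' : ∀ s, T < |s| → deriv (deriv g) s = 0 := fun s hs => hT2 s hs.le
  have hT3' : ∀ s, T < |s| → deriv (deriv (deriv g)) s = 0 := fun s hs => hT3 s hs.le
  have h0 := slideInequality hv hdiv hMpos hM hB h1 h2 hatt hc0 hc1 hcM hg hK0 hK1 hK2 hK3 hT1' hT2' hT3' hg0 hγ0 hslab hh₀ hfar
  -- the residue field `V = v − c`
  have hVs : ContDiff ℝ ∞ (fun y => v y - c) := hv.sub contDiff_const
  have hV2 : ContDiff ℝ 2 (fun y => v y - c) := hVs.of_le (WithTop.coe_le_coe.mpr le_top)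
  have hv1 : ContDiff ℝ 1 v := hv.of_le (WithTop.coe_le_coe.mpr le_top)
  have hdivV : VectorCalculus.IsDivFree (fun y => v y - c) := isDivFree_sub_const hdiv c
  have hMc : ∀ x, ‖v x‖ = ‖c‖ := fun x => by rw [hM x, hcM]
  have hVc : ∀ y, ⟪v y - c, c⟫ = -(‖v y - c‖ ^ 2 / 2) := fun y => inner_sub_const_eq_of_norm_eq hMc y
  have hc2 : c 2 ≠ 0 := by
    intro h
    have hn : ‖c‖ ^ 2 = c 0 ^ 2 + c 1 ^ 2 + c 2 ^ 2 := by
      rw [EuclideanSpace.norm_sq_eq, Fin.sum_univ_three]; simp [sq_abs]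
    rw [hc0, hc1, h, hcM] at hn
    nlinarith
  have hcurl : curl (fun y => v y - c) = curl v := curl_sub_const v c
  have hg3 : ContDiff ℝ 3 g := hg.of_le (WithTop.coe_le_coe.mpr le_top)
  -- one bound `K` for `g … g‴`
  set K : ℝ := max (max K0 K1) (max K2 K3) with hKdef
  have hK0' : ∀ s, |g s| ≤ K := fun s => (hK0 s).trans ((le_max_left _ _).trans (le_max_left _ _))
  have hK1' : ∀ s, |deriv g s| ≤ K := fun s => (hK1 s).trans ((le_max_right _ _).trans (le_max_left _ _))
  have hK2' : ∀ s, |deriv (deriv g) s| ≤ K := fun s => (hK2 s).trans ((le_max_left _ _).trans (le_max_right _ _))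
  have hK3' : ∀ s, |deriv (deriv (deriv g)) s| ≤ K := fun s => (hK3 s).trans ((le_max_right _ _).trans (le_max_right _ _))
  -- integrability inputs of `slideEnstrophyLaw_jet`
  have hD1 : Integrable (fun x => ‖iteratedFDeriv ℝ 1 v x‖ ^ 2) (volume : Measure (EuclideanSpace ℝ (Fin 3))) :=
    integrable_sq_norm_of_lintegral (hv.continuous_iteratedFDeriv (WithTop.coe_le_coe.mpr le_top)) h1
  have hD2 : Integrable (fun x => ‖iteratedFDeriv ℝ 2 v x‖ ^ 2) (volume : Measure (EuclideanSpace ℝ (Fin 3))) :=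
    integrable_sq_norm_of_lintegral (hv.continuous_iteratedFDeriv (WithTop.coe_le_coe.mpr le_top)) h2
  have hD : Integrable (fun x => ‖fderiv ℝ (fun y => v y - c) x‖ ^ 2) (volume : Measure (EuclideanSpace ℝ (Fin 3))) := by
    refine hD1.congr (Eventually.of_forall fun x => ?_)
    simp only [fderiv_sub_const]
    rw [← norm_iteratedFDeriv_fderiv, norm_iteratedFDeriv_zero]
  have mω : MemLp (curl v) 2 (volume : Measure (EuclideanSpace ℝ (Fin 3))) :=
    memLp_two_of_norm_le_mul (K := 4) (continuous_curl hv1) (hv.continuous_iteratedFDeriv (WithTop.coe_le_coe.mpr le_top))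
      hD1 fun x => by
        have := norm_iteratedFDeriv_curl_le_four hv 0 x
        rwa [norm_iteratedFDeriv_zero] at this
  have hZ : Integrable (fun x => ‖curl (fun y => v y - c) x‖ ^ 2) (volume : Measure (EuclideanSpace ℝ (Fin 3))) := by
    rw [hcurl]; exact integrable_sq_of_memLp_two mω
  obtain ⟨cDω, mDω⟩ := memLp_fderiv_curl hv h2
  have hZ2 : Integrable (fun x => ‖fderiv ℝ (curl (fun y => v y - c)) x (EuclideanSpace.single (2 : Fin 3) (1 : ℝ))‖ ^ 2)
      (volume : Measure (EuclideanSpace ℝ (Fin 3))) := by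
    rw [hcurl]
    refine (integrable_sq_of_memLp_two mDω).mono' ((cDω.clm_apply continuous_const).norm.pow 2).aestronglyMeasurable
      (Eventually.of_forall fun x => ?_)
    rw [Real.norm_eq_abs, abs_of_nonneg (sq_nonneg _)]
    refine pow_le_pow_left₀ (norm_nonneg _) ?_ 2
    calc ‖fderiv ℝ (curl v) x (EuclideanSpace.single (2 : Fin 3) (1 : ℝ))‖ ≤ ‖fderiv ℝ (curl v) x‖ * ‖(EuclideanSpace.single (2 : Fin 3) (1 : ℝ))‖ :=
        ContinuousLinearMap.le_opNorm _ _
      _ = ‖fderiv ℝ (curl v) x‖ := by rw [e2n, mul_one]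
  have hP2 : Integrable (fun x => ‖fderiv ℝ (fun y => fderiv ℝ (fun y => v y - c) y (EuclideanSpace.single (2 : Fin 3) (1 : ℝ))) x (EuclideanSpace.single (2 : Fin 3) (1 : ℝ))‖ ^ 2)
      (volume : Measure (EuclideanSpace ℝ (Fin 3))) := by
    simp only [fderiv_sub_const]
    have hc : Continuous fun x => fderiv ℝ (fun y => fderiv ℝ v y (EuclideanSpace.single (2 : Fin 3) (1 : ℝ))) x (EuclideanSpace.single (2 : Fin 3) (1 : ℝ)) :=
      ((((hv.fderiv_right (m := ∞) (by exact_mod_cast le_rfl)).clm_apply contDiff_const).continuous_fderiv (by simp)).clm_apply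
        continuous_const)
    refine hD2.mono' (hc.norm.pow 2).aestronglyMeasurable (Eventually.of_forall fun x => ?_)
    rw [Real.norm_eq_abs, abs_of_nonneg (sq_nonneg _)]
    exact pow_le_pow_left₀ (norm_nonneg _) (norm_fderiv_fderiv_apply_le hv x _ e2n) 2
  -- the enstrophy variation, explicitly (W′-line)
  have hA := slideEnstrophyLaw_jet (V := fun y => v y - c) (c := c) hV2 hdivV hVc hc0 hc1 hc2 hg3 hT hK0' hK1' hK2' hK3'
    hT1 hT2 hT3 hD hZ hZ2 hP2 hslab
  simp only [hcurl, fderiv_sub_const] at hA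
  have hneg : (∫ x, ⟪curl v x, curl (fun y : EuclideanSpace ℝ (Fin 3) => -(g (y 2) • fderiv ℝ v y (EuclideanSpace.single (2 : Fin 3) (1 : ℝ)) + deriv g (y 2) • (v y - c - (v y - c) 2 • EuclideanSpace.single (2 : Fin 3) (1 : ℝ)))) x⟫) =
      -(∫ x, ⟪curl v x, curl (fun y : EuclideanSpace ℝ (Fin 3) => g (y 2) • fderiv ℝ v y (EuclideanSpace.single (2 : Fin 3) (1 : ℝ)) + deriv g (y 2) • (v y - c - (v y - c) 2 • EuclideanSpace.single (2 : Fin 3) (1 : ℝ))) x⟫) := by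
    rw [← integral_neg]
    refine integral_congr_ae (Eventually.of_forall fun x => ?_)
    dsimp only
    rw [← inner_neg_right, ← curl_neg_apply]
  rw [hA] at hneg
  -- the two palinstrophy densities, explicitly
  have hR1 : (∫ x, ∑ i : Fin 3, ⟪fderiv ℝ (curl v) x (EuclideanSpace.basisFun (Fin 3) ℝ i),
            (fderiv ℝ (fun y : EuclideanSpace ℝ (Fin 3) => fderiv ℝ (curl (fun z : EuclideanSpace ℝ (Fin 3) => g (z 2) • (v z - c))) y - g (y 2) • fderiv ℝ (curl v) y) x (EuclideanSpace.single (2 : Fin 3) (1 : ℝ))) (EuclideanSpace.basisFun (Fin 3) ℝ i)⟫) =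
      ∫ x, deriv (deriv g) (x 2) * ⟪fderiv ℝ (curl v) x (EuclideanSpace.single (2 : Fin 3) (1 : ℝ)), curl v x⟫ +
        deriv g (x 2) * ‖fderiv ℝ (curl v) x (EuclideanSpace.single (2 : Fin 3) (1 : ℝ))‖ ^ 2 +
        deriv (deriv (deriv g)) (x 2) * ⟪fderiv ℝ (curl v) x (EuclideanSpace.single (2 : Fin 3) (1 : ℝ)),
          (-(v x - c) 1) • EuclideanSpace.single (0 : Fin 3) (1 : ℝ) + ((v x - c) 0) • EuclideanSpace.single (1 : Fin 3) (1 : ℝ)⟫ +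
        deriv (deriv g) (x 2) * ⟪fderiv ℝ (curl v) x (EuclideanSpace.single (2 : Fin 3) (1 : ℝ)),
          fderiv ℝ (fun z : EuclideanSpace ℝ (Fin 3) =>
            (-(v z - c) 1) • EuclideanSpace.single (0 : Fin 3) (1 : ℝ) + ((v z - c) 0) • EuclideanSpace.single (1 : Fin 3) (1 : ℝ)) x
            (EuclideanSpace.single (2 : Fin 3) (1 : ℝ))⟫ +
        ∑ i : Fin 3, (deriv (deriv g) (x 2) * ⟪fderiv ℝ (curl v) x (EuclideanSpace.basisFun (Fin 3) ℝ i),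
            fderiv ℝ (fun z : EuclideanSpace ℝ (Fin 3) =>
              (-(v z - c) 1) • EuclideanSpace.single (0 : Fin 3) (1 : ℝ) + ((v z - c) 0) • EuclideanSpace.single (1 : Fin 3) (1 : ℝ)) x
              (EuclideanSpace.basisFun (Fin 3) ℝ i)⟫ +
          deriv g (x 2) * ⟪fderiv ℝ (curl v) x (EuclideanSpace.basisFun (Fin 3) ℝ i),
            fderiv ℝ (fun y : EuclideanSpace ℝ (Fin 3) => fderiv ℝ (fun z : EuclideanSpace ℝ (Fin 3) =>
              (-(v z - c) 1) • EuclideanSpace.single (0 : Fin 3) (1 : ℝ) + ((v z - c) 0) • EuclideanSpace.single (1 : Fin 3) (1 : ℝ)) y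
              (EuclideanSpace.basisFun (Fin 3) ℝ i)) x (EuclideanSpace.single (2 : Fin 3) (1 : ℝ))⟫) := by
    refine integral_congr_ae (Eventually.of_forall fun x => ?_)
    have := sum_inner_fderiv_curlRemainder_axis (V := fun y => v y - c) hVs hg x
    simp only [hcurl] at this
    exact this
  have hR2 : (∫ x, ∑ i : Fin 3, ⟪fderiv ℝ (curl v) x (EuclideanSpace.basisFun (Fin 3) ℝ i),
            (fderiv ℝ (fun y : EuclideanSpace ℝ (Fin 3) => fderiv ℝ (fun z : EuclideanSpace ℝ (Fin 3) => deriv g (z 2) * (v z - c) 2) y (EuclideanSpace.single (1 : Fin 3) (1 : ℝ))) x (EuclideanSpace.basisFun (Fin 3) ℝ i)) • EuclideanSpace.single (0 : Fin 3) (1 : ℝ) -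
              (fderiv ℝ (fun y : EuclideanSpace ℝ (Fin 3) => fderiv ℝ (fun z : EuclideanSpace ℝ (Fin 3) => deriv g (z 2) * (v z - c) 2) y (EuclideanSpace.single (0 : Fin 3) (1 : ℝ))) x (EuclideanSpace.basisFun (Fin 3) ℝ i)) • EuclideanSpace.single (1 : Fin 3) (1 : ℝ)⟫) =
      ∫ x, deriv (deriv g) (x 2) * (fderiv ℝ (curl v) x (EuclideanSpace.single (2 : Fin 3) (1 : ℝ)) 0 * fderiv ℝ v x (EuclideanSpace.single (1 : Fin 3) (1 : ℝ)) 2 -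
          fderiv ℝ (curl v) x (EuclideanSpace.single (2 : Fin 3) (1 : ℝ)) 1 * fderiv ℝ v x (EuclideanSpace.single (0 : Fin 3) (1 : ℝ)) 2) +
        deriv g (x 2) * ∑ i : Fin 3, (fderiv ℝ (curl v) x (EuclideanSpace.basisFun (Fin 3) ℝ i) 0 *
            fderiv ℝ (fun y => fderiv ℝ v y (EuclideanSpace.single (1 : Fin 3) (1 : ℝ))) x (EuclideanSpace.basisFun (Fin 3) ℝ i) 2 -
          fderiv ℝ (curl v) x (EuclideanSpace.basisFun (Fin 3) ℝ i) 1 *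
            fderiv ℝ (fun y => fderiv ℝ v y (EuclideanSpace.single (0 : Fin 3) (1 : ℝ))) x (EuclideanSpace.basisFun (Fin 3) ℝ i) 2) := by
    refine integral_congr_ae (Eventually.of_forall fun x => ?_)
    have := sum_inner_slideCoeffDeriv (V := fun y => v y - c) hVs hg x
    simp only [hcurl, fderiv_sub_const] at this
    exact this
  -- the stretching variation, explicitly (identity (S))
  have hJ : (∫ x, (⟪curl (fun y : EuclideanSpace ℝ (Fin 3) => -(g (y 2) • fderiv ℝ v y (EuclideanSpace.single (2 : Fin 3) (1 : ℝ)) + deriv g (y 2) • (v y - c - (v y - c) 2 • EuclideanSpace.single (2 : Fin 3) (1 : ℝ)))) x, fderiv ℝ v x (curl v x)⟫ + ⟪curl v x, fderiv ℝ (fun y : EuclideanSpace ℝ (Fin 3) => -(g (y 2) • fderiv ℝ v y (EuclideanSpace.single (2 : Fin 3) (1 : ℝ)) + deriv g (y 2) • (v y - c - (v y - c) 2 • EuclideanSpace.single (2 : Fin 3) (1 : ℝ)))) x (curl v x)⟫ + ⟪curl v x, fderiv ℝ v x (curl (fun y : EuclideanSpace ℝ (Fin 3) => -(g (y 2) • fderiv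 ℝ v y (EuclideanSpace.single (2 : Fin 3) (1 : ℝ)) + deriv g (y 2) • (v y - c - (v y - c) 2 • EuclideanSpace.single (2 : Fin 3) (1 : ℝ)))) x)⟫)) =
      -(∫ x, (g (x 2) * fderiv ℝ (fun y : EuclideanSpace ℝ (Fin 3) => ⟪curl v y, fderiv ℝ v y (curl v y)⟫) x (EuclideanSpace.single (2 : Fin 3) (1 : ℝ)) +
        deriv g (x 2) *
          (⟪((-2 * fderiv ℝ v x (EuclideanSpace.single (2 : Fin 3) (1 : ℝ)) 1) • EuclideanSpace.single (0 : Fin 3) (1 : ℝ) + (2 * fderiv ℝ v x (EuclideanSpace.single (2 : Fin 3) (1 : ℝ)) 0) • EuclideanSpace.single (1 : Fin 3) (1 : ℝ) + (curl v x 2) • EuclideanSpace.single (2 : Fin 3) (1 : ℝ)), fderiv ℝ v x (curl v x)⟫ +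
            curl v x 2 * ⟪curl v x, fderiv ℝ v x (EuclideanSpace.single (2 : Fin 3) (1 : ℝ))⟫ +
            ⟪curl v x, fderiv ℝ v x (curl v x) - (fderiv ℝ v x (curl v x) 2) • EuclideanSpace.single (2 : Fin 3) (1 : ℝ)⟫ +
            ⟪curl v x, fderiv ℝ v x ((-2 * fderiv ℝ v x (EuclideanSpace.single (2 : Fin 3) (1 : ℝ)) 1) • EuclideanSpace.single (0 : Fin 3) (1 : ℝ) + (2 * fderiv ℝ v x (EuclideanSpace.single (2 : Fin 3) (1 : ℝ)) 0) • EuclideanSpace.single (1 : Fin 3) (1 : ℝ) + (curl v x 2) • EuclideanSpace.single (2 : Fin 3) (1 : ℝ))⟫) +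
        deriv (deriv g) (x 2) *
          (⟪((-(v x - c) 1) • EuclideanSpace.single (0 : Fin 3) (1 : ℝ) + ((v x - c) 0) • EuclideanSpace.single (1 : Fin 3) (1 : ℝ)), fderiv ℝ v x (curl v x)⟫ +
            curl v x 2 * ⟪curl v x, v x - c - ((v x - c) 2) • EuclideanSpace.single (2 : Fin 3) (1 : ℝ)⟫ +
            ⟪curl v x, fderiv ℝ v x ((-(v x - c) 1) • EuclideanSpace.single (0 : Fin 3) (1 : ℝ) + ((v x - c) 0) • EuclideanSpace.single (1 : Fin 3) (1 : ℝ))⟫))) := by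
    rw [← integral_neg]
    refine integral_congr_ae (Eventually.of_forall fun x => ?_)
    have hS := stretchingDensity_slideGenerator (V := fun y => v y - c) hVs hg x
    simp only [hcurl, fderiv_sub_const] at hS
    have hN := stretchingDensity_neg (V := fun y => v y - c)
      (fun y : EuclideanSpace ℝ (Fin 3) => g (y 2) • fderiv ℝ v y (EuclideanSpace.single (2 : Fin 3) (1 : ℝ)) + deriv g (y 2) • (v y - c - (v y - c) 2 • EuclideanSpace.single (2 : Fin 3) (1 : ℝ))) x
    simp only [hcurl, fderiv_sub_const] at hN
    dsimp only
    rw [hN, hS]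
  rw [hJ, hneg, hR1, hR2] at h0
  exact h0

end ExtremiserLiouville

end Summit.NavierStokesRegularity.NavierStokesRegularity.Theorems

end
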